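import Mathlib
import Literature.Computability.AlgebraicComplexity.GroupTheoreticMatMul
import Summits.MatrixMultiplication.MatrixMultiplication.Theses.ThinBlockAlpha

/-!
# Triage r1/k3 — kill of the C⁺ of idea `ruled-graph-thin-designs` (crux stmt-MatrixMultiplication-10595)

The definitions `Pl`, `legA`, `legB`, `legC`, `Condition`, `RuledGraphThinDesigns` below are
VERBATIM copies of `Cruxes/ThinPackings/Ideator1Sketch.lean` (namespace `…RuledGraph`; that module
is not built on the farm, so it cannot be imported here).

* `condition_sum_card_le` — the card's "VM-cap conjecture" (cheapest falsifier F1) with constant 1: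
  `Condition d e f g W → Σ_i |W i| ≤ |V|`.  Proof: every A-line passes over the plane origin
  (`x • d i = 0` at `x = 0`), so the clause at `j = k`, `x = x' = 0`, `y = y'` says that the sets
  `f i 0 − W i` (`i < L`) are pairwise disjoint in `V` — the `A−B` packing read in the fibre over
  the origin.
* `not_ruledGraphThinDesigns` — hence `|H| = q²|V| ≥ L·q²·M = L·N²·M` (the coset bound), and the
  transferred statement C⁺ is FALSE at every `(a, η)` with `η < a` (witness `a = 1/2, η = 1/4`).
-/

set_option linter.dupNamespace false  -- `Summit.<S>.<S>.…` is the mandated namespace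

open Literature.Computability.AlgebraicComplexity Finset

namespace Summit.MatrixMultiplication.MatrixMultiplication.Cruxes.ThinPackings.Triage3

/-- The incidence plane (copy of `RuledGraph.Pl`). -/
abbrev Pl (q : ℕ) : Type := ZMod q × ZMod q

section Legs

variable {q : ℕ} [NeZero q] {V : Type} [AddCommGroup V] [DecidableEq V]

/-- Copy of `RuledGraph.legA`. -/
def legA (d : Pl q) (f : ZMod q → V) : Finset (Pl q × V) :=
  Finset.univ.image fun x : ZMod q => (x • d, f x)

/-- Copy of `RuledGraph.legC`. -/
def legC (e : Pl q) (g : ZMod q → V) : Finset (Pl q × V) :=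
  Finset.univ.image fun y : ZMod q => (y • e, g y)

/-- Copy of `RuledGraph.legB`. -/
def legB (q : ℕ) (W : Finset V) : Finset (Pl q × V) :=
  W.image fun w => ((0 : Pl q), w)

/-- Copy of `RuledGraph.Condition` (the STPP clause in ruled-graph coordinates). -/
def Condition {L : ℕ} (d e : Fin L → Pl q) (f g : Fin L → ZMod q → V)
    (W : Fin L → Finset V) : Prop :=
  ∀ i j k : Fin L, ∀ x x' y y' : ZMod q, ∀ w ∈ W i, ∀ w' ∈ W j,
    (x' • d i - x • d k) + (y' • e k - y • e j) = 0 →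
    (f i x' - f k x) + (w' - w) + (g k y' - g j y) = 0 →
    i = j ∧ j = k ∧ x = x' ∧ y = y' ∧ w = w'

end Legs

/-- Copy of `RuledGraph.RuledGraphThinDesigns` (the card's C⁺). -/
def RuledGraphThinDesigns : Prop :=
  ∀ a : ℝ, 0 ≤ a → a < 1 → ∀ η : ℝ, 0 < η →
    ∃ (q : ℕ) (_ : NeZero q) (V : Type) (_ : AddCommGroup V) (_ : Fintype V) (_ : DecidableEq V)
      (L M : ℕ) (d e : Fin L → Pl q) (f g : Fin L → ZMod q → V) (W : Fin L → Finset V),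
      2 ≤ q ∧ (∀ i, (W i).Nonempty) ∧ Condition d e f g W ∧ (∀ i, (W i).card = M) ∧
        (q : ℝ) ^ a ≤ M ∧
        (q : ℝ) ^ 2 * Fintype.card V ≤ L * (q : ℝ) ^ (2 + η)

/-- **VM-cap with constant 1.**  Under `Condition`, the multiplier sets shifted by the values of
the A-maps at the origin, `f i 0 − W i`, are pairwise disjoint in `V`; hence `Σ_i |W i| ≤ |V|`.
(Clause `j = k`, `x = x' = 0`, `y = y' = 0`: the plane equation is trivial and the value equation
reads `f i 0 − w = f k 0 − w'`.) [new, elementary] -/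
theorem condition_sum_card_le {q : ℕ} [NeZero q] {V : Type} [AddCommGroup V] [Fintype V]
    [DecidableEq V] {L : ℕ} (d e : Fin L → Pl q) (f g : Fin L → ZMod q → V)
    (W : Fin L → Finset V) (h : Condition d e f g W) :
    ∑ i, (W i).card ≤ Fintype.card V := by
  classical
  have hinj : Set.InjOn (fun x : (Σ _ : Fin L, V) => f x.1 0 - x.2)
      ↑(Finset.univ.sigma W) := by
    rintro ⟨i, w⟩ hx ⟨k, w'⟩ hy hxy
    simp only [coe_sigma, Set.mem_sigma_iff, coe_univ, Set.mem_univ, true_and, mem_coe] at hx hy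
    change f i 0 - w = f k 0 - w' at hxy
    have hplane : ((0 : ZMod q) • d i - (0 : ZMod q) • d k) +
        ((0 : ZMod q) • e k - (0 : ZMod q) • e k) = 0 := by
      simp
    have hval : (f i 0 - f k 0) + (w' - w) + (g k 0 - g k 0) = 0 := by
      have : (f i 0 - f k 0) + (w' - w) + (g k 0 - g k 0) = (f i 0 - w) - (f k 0 - w') := by
        abel
      rw [this, hxy, sub_self]
    obtain ⟨hik, -, -, -, hw⟩ := h i k k 0 0 0 0 w hx w' hy hplane hval
    subst hik
    subst hw
    rfl
  calc ∑ i, (W i).card = (Finset.univ.sigma W).card := by rw [card_sigma]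
    _ = ((Finset.univ.sigma W).image fun x : (Σ _ : Fin L, V) => f x.1 0 - x.2).card :=
        (card_image_of_injOn hinj).symm
    _ ≤ Fintype.card V := card_le_univ _

/-- **The coset bound for vertical-multiplier ruled-graph designs**: with all `|W i| = M`,
`L · M ≤ |V|`, i.e. `|H| = q² |V| ≥ L · q² · M = L · N² · M`. [new, elementary] -/
theorem condition_mul_le {q : ℕ} [NeZero q] {V : Type} [AddCommGroup V] [Fintype V]
    [DecidableEq V] {L M : ℕ} (d e : Fin L → Pl q) (f g : Fin L → ZMod q → V)
    (W : Fin L → Finset V) (h : Condition d e f g W) (hW : ∀ i, (W i).card = M) :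
    L * M ≤ Fintype.card V := by
  have hsum := condition_sum_card_le d e f g W h
  rwa [Finset.sum_congr rfl (fun i _ => hW i), sum_const, card_univ, Fintype.card_fin,
    smul_eq_mul] at hsum

/-- **C⁺ of the card is false**: `RuledGraphThinDesigns` fails at `a = 1/2`, `η = 1/4` (indeed at
every `η < a`): `q² · L · M ≤ q² |V| ≤ L · q^{2+η}` forces `M ≤ q^η < q^a ≤ M`.
[new, elementary] -/
theorem not_ruledGraphThinDesigns : ¬ RuledGraphThinDesigns := by
  intro h
  obtain ⟨q, hq0, V, _, _, _, L, M, d, e, f, g, W, hq, -, hcond, hW, hM, hP⟩ :=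
    h (1 / 2) (by norm_num) (by norm_num) (1 / 4) (by norm_num)
  have hLM : L * M ≤ Fintype.card V := condition_mul_le d e f g W hcond hW
  have hLMr : (L : ℝ) * M ≤ Fintype.card V := by exact_mod_cast hLM
  have hq2 : (2 : ℝ) ≤ q := by exact_mod_cast hq
  have hq1 : (1 : ℝ) < q := by linarith
  have hqpos : (0 : ℝ) < q := by linarith
  have hVpos : (0 : ℝ) < Fintype.card V := by exact_mod_cast Fintype.card_pos
  have hLpos : (0 : ℝ) < L := by
    by_contra hL
    push Not at hL
    have hL0 : (L : ℝ) = 0 := le_antisymm hL (Nat.cast_nonneg L)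
    rw [hL0, zero_mul] at hP
    have : (0 : ℝ) < (q : ℝ) ^ 2 * Fintype.card V := by positivity
    linarith
  have h1 : (q : ℝ) ^ 2 * ((L : ℝ) * M) ≤ L * (q : ℝ) ^ (2 + 1 / 4 : ℝ) :=
    (mul_le_mul_of_nonneg_left hLMr (by positivity)).trans hP
  have h2 : (q : ℝ) ^ 2 * (M : ℝ) ≤ (q : ℝ) ^ (2 + 1 / 4 : ℝ) := by
    have h1' : (L : ℝ) * ((q : ℝ) ^ 2 * M) ≤ L * (q : ℝ) ^ (2 + 1 / 4 : ℝ) := by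
      calc (L : ℝ) * ((q : ℝ) ^ 2 * M) = (q : ℝ) ^ 2 * ((L : ℝ) * M) := by ring
        _ ≤ L * (q : ℝ) ^ (2 + 1 / 4 : ℝ) := h1
    exact le_of_mul_le_mul_left h1' hLpos
  have h3 : (q : ℝ) ^ (2 + 1 / 4 : ℝ) = (q : ℝ) ^ 2 * (q : ℝ) ^ (1 / 4 : ℝ) := by
    rw [Real.rpow_add hqpos, Real.rpow_two]
  rw [h3] at h2
  have h4 : (M : ℝ) ≤ (q : ℝ) ^ (1 / 4 : ℝ) := le_of_mul_le_mul_left h2 (by positivity)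
  have h5 : (q : ℝ) ^ (1 / 4 : ℝ) < (q : ℝ) ^ (1 / 2 : ℝ) :=
    Real.rpow_lt_rpow_of_exponent_lt hq1 (by norm_num)
  linarith

end Summit.MatrixMultiplication.MatrixMultiplication.Cruxes.ThinPackings.Triage3
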